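import Summits.QuantumFields.YangMills.Theorems.BalabanUVNodesN15KingModelPotentialBlockMeanGrad
import Summits.QuantumFields.YangMills.Theorems.BalabanUVNodesN15KingModelPotentialSiteSizeOnly

/-!
# N15 (NE2⁺), King-model rung, part 23b: SIZE ALONE DOES NOT GIVE THE GRADIENT SITE ENTRY — `¬ NE2PlusSite` for `dkingHSiteV` on the size-only sort

Cell `pub-ymgap-dag-n15-d` (R134 acceleration DAG, node N15 = NE2, strategy s3 KING-MODEL RUNG), part 23b.  Part 19b inhabited `NE2PlusSite` for the
`p = 1` (GRADIENT) sup entry `dkingHSiteV` of the dressed minimiser BY NAME on the size-and-coherence sort; part 21 showed that the `p = 0` entry FAILS the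
predicate on part 8c's size-only sort `potBg` (witness tower `v_{L^k} ≡ c`, `v_N ≡ 0` else).  THIS FILE proves the same for the gradient entry — the last of
the lineage's by-name layers — so that ALL FOUR statements (the (H3) letter, both (3.133) site entries, the unit layer) are now decided both ways:

* §1 `blockMean_massDiff_ge`: the block mean over `B(b)` of `D = ℋ_k^{m²}(·,b) − ℋ_k^{m²+c}(·,b)` is `≥ g₁ = G_min∕a > 0` (parts 20∕21);
  `sum_abs_blockMean_massDiff_le`: by the decay of both minimisers (part 8b) the block means of `D` are absolutely summable over the unit torus with a
  VOLUME-UNIFORM total `Tot`;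
* §2 ★ `dsiteSup_sizeOnly_ge`: on a King-admissible torus chosen large enough (`2L^{e+1}·g₁ > 2·Tot`, fixed BEFORE `k`), the axis line through `b` contains a
  block with mean `≤ g₁∕2` (part 23a `exists_le_of_sum_abs_le`), so some unit step on that line drops the mean by `≥ g₂ = g₁∕(4L^{e+1})` (`exists_step_ge`),
  so some fine point `w` has `|∂^η_0D(w)| ≥ g₂` (`exists_grad_ge_of_blockMean_step`); reading the witness tower's `p = 1` entry at `(B(w), b)` through the fine
  point over `w` and subtracting the undressed gradient step (18d `dkingH_step_kingU`, `γ = 1∕2`) gives `sup ≥ g₂ − C_D(L^{−1∕4})^k`;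
* §3 `dkingHSiteV_sizeOnly_ge` (the same, phrased for `dkingHSiteV` on the part-8c family) and ★★ `not_ne2PlusSite_dkingHV :
  ¬ NE2PlusSite d′ p c₃₅ (kingInstanceV L s) (dkingHSiteV L a m² s)` for every `c₃₅ > 0`, `s`, `d′`, `p`.

HONEST SCOPE.  King's A = 0 scalar model on the King-admissible tori `Π ℤ∕(2L^{e+1})`, odd `L ≥ 3`, `a, m² > 0`; scalar potentials (NOT gauge fields); a
NEGATIVE statement about THIS LINEAGE's family∕sort (`kingInstanceV`, size-only (3.35) slot), not about a printed proposition and not about Bałaban's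
`H_k(U)`; count-neutral (`--supports`), not a discharge of N15; THEOREMS ONLY (0 `def`, 0 `sorry`), standard axioms.

References: C. King, Commun. Math. Phys. 102 (1986) 649–677: (2.13)–(2.15) p.653, Theorem 3.3 p.655 ((3.7) p.656), Prop. 3.8 (3.71) p.664 (second
line), (4.5) p.670 (bib key `King1986`); [B9] = Bałaban, Commun. Math. Phys. 102 (1985) 385–462, (3.35)–(3.36) p.396, (3.133) p.422, Thm 3.14
pp.426–427 (quantifier template) (bib key `Balaban1985BackgroundPropagators`).
-/

noncomputable section
open scoped BigOperators Matrix
open Finset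

namespace Summit.QuantumFields.YangMills.BalabanUVNodes.N15.KingModel

open Literature.MathematicalPhysics.QuantumFieldTheory.Balaban1983to89 hiding blockOf
open Literature.MathematicalPhysics.QuantumFieldTheory.Balaban1983to89.T4EtaRate (PairedInstance NE2PlusSite EtaRateIneqSite rateFactor)
open Literature.MathematicalPhysics.QuantumFieldTheory.Balaban1983to89.B4Sect5Proof (latticeConst latticeConst_nonneg)
open Literature.MathematicalPhysics.QuantumFieldTheory.Balaban1983to89.B5Prop11Plancherel (Tor fine unitVec)
open Literature.MathematicalPhysics.QuantumFieldTheory.King1986 (aK aK_pos)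
open Literature.MathematicalPhysics.QuantumFieldTheory.King1986.Torus
open Summit.QuantumFields.YangMills.BalabanUVNodes.N15KingModelRung (kingH kingBlockFibre mem_kingBlockFibre kingBlockFibre_nonempty)
open Summit.QuantumFields.YangMills.BalabanUVNodes.N15KingModelRung.Curved (underPtN val_underPtN blockOf_underPtN)
open Real

variable {d : ℕ}

/-! ## §1 The block means of the mass difference: lower bound at the source block, absolute summability -/

section Means

variable (L : ℕ) [NeZero L]

/-- **THE BLOCK MEAN OF `ℋ_k^{m²}(·,b) − ℋ_k^{m²+c}(·,b)` OVER `B(b)` IS `≥ G_min∕a`** (`L ≥ 2`, `a, m² > 0`, `c > 0`, `k ≥ 1`, `N = L^k`; any unit torus):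
`a_k⁻¹(Δ^{(k)}_{m²+c} − Δ^{(k)}_{m²})(b,b)` by part 20's `blockMean_kingH_eq`, bounded below by part 21's mass gap. [cite: King1986, (2.13)–(2.14) p.653, (4.5) p.670] -/
theorem blockMean_massDiff_ge {N : ℕ} [NeZero N] (U : Fin (d + 1) → ℕ) [∀ μ, NeZero (U μ)] (hL : 2 ≤ L) {a m2 : ℝ} (ha : 0 < a) (hm : 0 < m2)
    {c : ℝ} (hc : 0 < c) {k : ℕ} (hk : 1 ≤ k) (hN : N = L ^ k) (b : Tor U) :
    (4 / π ^ 2) ^ (d + 1) * c / ((((d + 1 : ℕ) : ℝ) * π ^ 2 + m2) * (((d + 1 : ℕ) : ℝ) * π ^ 2 + (m2 + c)))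
        * (((aminL a L)⁻¹ + (m2 + c)⁻¹)⁻¹ * ((aminL a L)⁻¹ + m2⁻¹)⁻¹) / a
      ≤ (((N : ℕ) : ℝ) ^ (d + 1))⁻¹ * ∑ j : Fin (d + 1) → Fin N,
          (kingH L N U a m2 k b (site N U b j) - kingH L N U a (m2 + c) k b (site N U b j)) := by
  set Gm : ℝ := (4 / π ^ 2) ^ (d + 1) * c / ((((d + 1 : ℕ) : ℝ) * π ^ 2 + m2) * (((d + 1 : ℕ) : ℝ) * π ^ 2 + (m2 + c)))
    * (((aminL a L)⁻¹ + (m2 + c)⁻¹)⁻¹ * ((aminL a L)⁻¹ + m2⁻¹)⁻¹) with hGmdef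
  have hamin : 0 < aminL a L := aminL_pos ha hL
  have hGm : 0 < Gm := by positivity
  have hLr : (1 : ℝ) < L := by exact_mod_cast (show 1 < L by omega)
  have hak : 0 < aK a L k := aK_pos ha hLr hk
  have hamk : aminL a L ≤ aK a L k := (aminL_le_aK ha hL hk).1
  have haka : aK a L k ≤ a := (aminL_le_aK ha hL hk).2
  have hN1 : 1 ≤ N := by rw [hN]; exact Nat.one_le_pow _ _ (by omega)
  have hmean : (((N : ℕ) : ℝ) ^ (d + 1))⁻¹ * ∑ j : Fin (d + 1) → Fin N,
      (kingH L N U a m2 k b (site N U b j) - kingH L N U a (m2 + c) k b (site N U b j))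
      = (aK a L k)⁻¹ * (effLaplacian N U (aK a L k) (((N : ℕ) : ℝ) ^ 2) (m2 + c) b b
          - effLaplacian N U (aK a L k) (((N : ℕ) : ℝ) ^ 2) m2 b b) := by
    have h1 := blockMean_kingH_eq N U L a m2 hak.ne' b
    have h2 := blockMean_kingH_eq N U L a (m2 + c) hak.ne' b
    rw [Finset.sum_sub_distrib, mul_sub, h1, h2]
    ring
  have hgap := effLaplacian_mass_gap_diag N U hN1 hak hm hc b
  have hmono : Gm ≤ (4 / π ^ 2) ^ (d + 1) * c / ((((d + 1 : ℕ) : ℝ) * π ^ 2 + m2) * (((d + 1 : ℕ) : ℝ) * π ^ 2 + (m2 + c)))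
      * (((aK a L k)⁻¹ + (m2 + c)⁻¹)⁻¹ * ((aK a L k)⁻¹ + m2⁻¹)⁻¹) := by
    have hi : (aK a L k)⁻¹ ≤ (aminL a L)⁻¹ := inv_anti₀ hamin hamk
    exact mul_le_mul_of_nonneg_left (mul_le_mul (inv_anti₀ (by positivity) (by linarith))
      (inv_anti₀ (by positivity) (by linarith)) (by positivity) (by positivity)) (by positivity)
  rw [hmean, div_eq_inv_mul]
  exact mul_le_mul (inv_anti₀ hak haka) (hmono.trans hgap) hGm.le (inv_nonneg.mpr hak.le)

/-- **THE BLOCK MEANS OF THE MASS DIFFERENCE ARE ABSOLUTELY SUMMABLE, UNIFORMLY IN THE VOLUME** (odd `L ≥ 3`, `a, m² > 0`, `c > 0`): there is `Tot > 0`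
with `Σ_y |N^{−(d+1)}Σ_j (ℋ_k^{m²} − ℋ_k^{m²+c})(site(y,j), b)| ≤ Tot` for every volume exponent, `k ≥ 1` and `b` (Theorem 3.3 decay of both minimisers,
part 8b `kingH_decay_kingU`, summed by `tdistT_sumBound`). [cite: King1986, Theorem 3.3 p.655, (3.7) p.656, (4.41) p.675 (summation)] -/
theorem sum_abs_blockMean_massDiff_le (hLodd : Odd L) (hL : 2 ≤ L) {a m2 : ℝ} (ha : 0 < a) (hm : 0 < m2) {c : ℝ} (hc : 0 < c) :
    ∃ Tot : ℝ, 0 < Tot ∧ ∀ (e k : ℕ), 1 ≤ k → ∀ b : Tor (kingU d L e),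
      ∑ y : Tor (kingU d L e), |((((L ^ k : ℕ) : ℝ)) ^ (d + 1))⁻¹ * ∑ j : Fin (d + 1) → Fin (L ^ k),
          (kingH L (L ^ k) (kingU d L e) a m2 k b (site (L ^ k) (kingU d L e) y j)
            - kingH L (L ^ k) (kingU d L e) a (m2 + c) k b (site (L ^ k) (kingU d L e) y j))| ≤ Tot := by
  obtain ⟨δ₁, c₁, hδ₁, hc₁, H₁⟩ := kingH_decay_kingU (d := d) L hLodd hL ha hm.le
  obtain ⟨δ₂, c₂, hδ₂, hc₂, H₂⟩ := kingH_decay_kingU (d := d) L hLodd hL ha (by linarith : (0 : ℝ) ≤ m2 + c)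
  have hK₁ := latticeConst_nonneg (d + 1) hδ₁.le
  have hK₂ := latticeConst_nonneg (d + 1) hδ₂.le
  refine ⟨c₁ * latticeConst (d + 1) δ₁ + c₂ * latticeConst (d + 1) δ₂ + 1, by positivity, fun e k hk b => ?_⟩
  have hD : (0 : ℝ) < (((L ^ k : ℕ) : ℝ)) ^ (d + 1) := pow_pos (Nat.cast_pos.mpr (Nat.pos_of_ne_zero (NeZero.ne _))) _
  -- each block mean is dominated by the two decay profiles at its block
  have hy : ∀ y : Tor (kingU d L e), |((((L ^ k : ℕ) : ℝ)) ^ (d + 1))⁻¹ * ∑ j : Fin (d + 1) → Fin (L ^ k),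
      (kingH L (L ^ k) (kingU d L e) a m2 k b (site (L ^ k) (kingU d L e) y j) - kingH L (L ^ k) (kingU d L e) a (m2 + c) k b (site (L ^ k) (kingU d L e) y j))|
      ≤ c₁ * Real.exp (-(δ₁ * tdistT (kingU d L e) y b)) + c₂ * Real.exp (-(δ₂ * tdistT (kingU d L e) y b)) := by
    intro y
    rw [abs_mul, abs_of_pos (inv_pos.mpr hD), inv_mul_le_iff₀ hD]
    calc |∑ j : Fin (d + 1) → Fin (L ^ k), (kingH L (L ^ k) (kingU d L e) a m2 k b (site (L ^ k) (kingU d L e) y j)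
            - kingH L (L ^ k) (kingU d L e) a (m2 + c) k b (site (L ^ k) (kingU d L e) y j))|
        ≤ ∑ j : Fin (d + 1) → Fin (L ^ k), |kingH L (L ^ k) (kingU d L e) a m2 k b (site (L ^ k) (kingU d L e) y j)
            - kingH L (L ^ k) (kingU d L e) a (m2 + c) k b (site (L ^ k) (kingU d L e) y j)| := abs_sum_le_sum_abs _ _
      _ ≤ ∑ _j : Fin (d + 1) → Fin (L ^ k), (c₁ * Real.exp (-(δ₁ * tdistT (kingU d L e) y b)) + c₂ * Real.exp (-(δ₂ * tdistT (kingU d L e) y b))) := by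
          refine Finset.sum_le_sum fun j _ => (abs_sub _ _).trans (add_le_add ?_ ?_)
          · have h := H₁ e k hk (L ^ k) rfl b (site (L ^ k) (kingU d L e) y j)
            rwa [blockOf_site] at h
          · have h := H₂ e k hk (L ^ k) rfl b (site (L ^ k) (kingU d L e) y j)
            rwa [blockOf_site] at h
      _ = (((L ^ k : ℕ) : ℝ)) ^ (d + 1) * (c₁ * Real.exp (-(δ₁ * tdistT (kingU d L e) y b)) + c₂ * Real.exp (-(δ₂ * tdistT (kingU d L e) y b))) := by
          rw [Finset.sum_const, Finset.card_univ, nsmul_eq_mul, card_offsets (L ^ k)]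
  have hsym : ∀ y : Tor (kingU d L e), tdistT (kingU d L e) y b = tdistT (kingU d L e) b y := fun y => (tdistT_isPseudoDist (kingU d L e)).symm y b
  calc ∑ y : Tor (kingU d L e), |((((L ^ k : ℕ) : ℝ)) ^ (d + 1))⁻¹ * ∑ j : Fin (d + 1) → Fin (L ^ k),
          (kingH L (L ^ k) (kingU d L e) a m2 k b (site (L ^ k) (kingU d L e) y j) - kingH L (L ^ k) (kingU d L e) a (m2 + c) k b (site (L ^ k) (kingU d L e) y j))|
      ≤ ∑ y : Tor (kingU d L e), (c₁ * Real.exp (-(δ₁ * tdistT (kingU d L e) y b)) + c₂ * Real.exp (-(δ₂ * tdistT (kingU d L e) y b))) := Finset.sum_le_sum fun y _ => hy y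
    _ = c₁ * ∑ y : Tor (kingU d L e), Real.exp (-(δ₁ * tdistT (kingU d L e) b y)) + c₂ * ∑ y : Tor (kingU d L e), Real.exp (-(δ₂ * tdistT (kingU d L e) b y)) := by
        rw [Finset.sum_add_distrib, Finset.mul_sum, Finset.mul_sum]
        simp only [hsym]
    _ ≤ c₁ * latticeConst (d + 1) δ₁ + c₂ * latticeConst (d + 1) δ₂ :=
        add_le_add (mul_le_mul_of_nonneg_left (tdistT_sumBound (kingU d L e) δ₁ hδ₁ b) hc₁.le)
          (mul_le_mul_of_nonneg_left (tdistT_sumBound (kingU d L e) δ₂ hδ₂ b) hc₂.le)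
    _ ≤ _ := by linarith

end Means

/-! ## §2 The gradient sup entry of the witness tower is bounded below somewhere -/

section Lower

variable (L : ℕ) [NeZero L]

/-- **SOMEWHERE THE GRADIENT OF `ℋ^{m²}_k − ℋ^{m²+c}_k` IS LARGE, HENCE SO IS THE `p = 1` SUP ENTRY OF THE INCOHERENT WITNESS** (odd `L ≥ 3`,
`a, m² > 0`, `c > 0`): there are a volume exponent `e` and `g > 0`, `C ≥ 0` such that for every `k ≥ 1` and every source block `b` of `Π ℤ∕(2L^{e+1})`,
SOME observation block `y` has
`sup_{B(x′) = y} Σ_μ |N′(ℋ^{m²}_{k+1}(x′+ε′_μ,b) − ℋ^{m²}_{k+1}(x′,b)) − N(ℋ^{m²+c}_k(x+ε_μ,b) − ℋ^{m²+c}_k(x,b))| ≥ g − C·(L^{−1∕4})^k` (`x` under `x′`;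
module docstring §2). [cite: King1986, (2.13)–(2.15) p.653, Theorem 3.3 p.655, Prop. 3.8 (3.71) p.664 (second line), (4.5) p.670 (A = 0 model)] -/
theorem dsiteSup_sizeOnly_ge (hLodd : Odd L) (hL : 2 ≤ L) {a m2 : ℝ} (ha : 0 < a) (hm : 0 < m2) {c : ℝ} (hc : 0 < c) :
    ∃ (e : ℕ) (g C : ℝ), 0 < g ∧ 0 ≤ C ∧ ∀ (k : ℕ), 1 ≤ k → ∀ b : Tor (kingU d L e), ∃ y : Tor (kingU d L e),
      g - C * ((L : ℝ) ^ (-((1 / 2 : ℝ) / 2))) ^ k ≤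
        (kingBlockFibre (L ^ 1 * L ^ k) (kingU d L e) y).sup' (kingBlockFibre_nonempty _ _ y) (fun x' =>
          ∑ μ : Fin (d + 1), |((L ^ 1 * L ^ k : ℕ) : ℝ) *
              (kingH L (L ^ 1 * L ^ k) (kingU d L e) a m2 (k + 1) b (x' + unitVec (fine (L ^ 1 * L ^ k) (kingU d L e)) μ)
                - kingH L (L ^ 1 * L ^ k) (kingU d L e) a m2 (k + 1) b x')
            - ((L ^ k : ℕ) : ℝ) *
              (kingH L (L ^ k) (kingU d L e) a (m2 + c) k b (underPtN L k 1 (kingU d L e) x' + unitVec (fine (L ^ k) (kingU d L e)) μ)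
                - kingH L (L ^ k) (kingU d L e) a (m2 + c) k b (underPtN L k 1 (kingU d L e) x'))|) := by
  have hL1 : 1 < L := by omega
  have hLr : (1 : ℝ) < L := by exact_mod_cast hL1
  have hamin : 0 < aminL a L := aminL_pos ha hL
  -- the source-block mean `g₁`, the total `Tot`, the undressed gradient step
  set g₁ : ℝ := (4 / π ^ 2) ^ (d + 1) * c / ((((d + 1 : ℕ) : ℝ) * π ^ 2 + m2) * (((d + 1 : ℕ) : ℝ) * π ^ 2 + (m2 + c)))
    * (((aminL a L)⁻¹ + (m2 + c)⁻¹)⁻¹ * ((aminL a L)⁻¹ + m2⁻¹)⁻¹) / a with hg₁def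
  have hg₁ : 0 < g₁ := by positivity
  obtain ⟨Tot, hTot, HT⟩ := sum_abs_blockMean_massDiff_le (d := d) L hLodd hL ha hm hc
  obtain ⟨δD, CD, hδD, hCD, HD⟩ := dkingH_step_kingU (d := d) L hLodd hL ha hm (γ := 1 / 2) (by norm_num) (by norm_num)
  -- a volume large enough: `L^e·g₁ > Tot`
  obtain ⟨e, he⟩ := pow_unbounded_of_one_lt (Tot / g₁) hLr
  have hU0 : ((kingU d L e 0 : ℕ) : ℝ) = 2 * (L : ℝ) ^ (e + 1) := by
    show (((L * (2 * L ^ e) : ℕ)) : ℝ) = 2 * (L : ℝ) ^ (e + 1)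
    push_cast
    ring
  have hU0pos : 0 < kingU d L e 0 := Nat.pos_of_ne_zero (NeZero.ne _)
  have hbig : Tot < ((kingU d L e 0 : ℕ) : ℝ) * (g₁ / 2) := by
    rw [hU0, div_lt_iff₀ hg₁] at *
    have hLe : (L : ℝ) ^ e ≤ (L : ℝ) ^ (e + 1) := pow_le_pow_right₀ hLr.le (by omega)
    nlinarith
  set θ : ℝ := (L : ℝ) ^ (-((1 / 2 : ℝ) / 2)) with hθdef
  have hθ0 : 0 ≤ θ := Real.rpow_nonneg (Nat.cast_nonneg _) _
  refine ⟨e, g₁ / 2 / ((kingU d L e 0 : ℕ) : ℝ), CD, by positivity, hCD.le, fun k hk b => ?_⟩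
  -- the mass difference and its block means
  set D : Tor (fine (L ^ k) (kingU d L e)) → ℝ := fun x => kingH L (L ^ k) (kingU d L e) a m2 k b x - kingH L (L ^ k) (kingU d L e) a (m2 + c) k b x with hDdef
  set M : Tor (kingU d L e) → ℝ := fun y => ((((L ^ k : ℕ) : ℝ)) ^ (d + 1))⁻¹ * ∑ j : Fin (d + 1) → Fin (L ^ k), D (site (L ^ k) (kingU d L e) y j) with hMdef
  have hMb : g₁ ≤ M b := blockMean_massDiff_ge L (kingU d L e) hL ha hm hc hk rfl b
  have hTotM : ∑ y, |M y| ≤ Tot := HT e k hk b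
  -- the axis line through `b`
  set f : ℕ → ℝ := fun s => M (b + s • unitVec (kingU d L e) 0) with hfdef
  have hline : ∑ s ∈ Finset.range ((kingU d L e) 0), |f s| ≤ Tot :=
    (sum_line_le_sum (kingU d L e) (fun y => |M y|) (fun y => abs_nonneg _) b 0).trans hTotM
  obtain ⟨s₁, hs₁U, hs₁⟩ := exists_le_of_sum_abs_le f (Nat.one_le_iff_ne_zero.mpr (NeZero.ne _)) hline hbig
  have hf0 : f 0 = M b := by simp only [hfdef, zero_smul, add_zero]
  have hs₁pos : 1 ≤ s₁ := by
    rcases Nat.eq_zero_or_pos s₁ with h0 | hpos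
    · exfalso
      rw [h0, hf0] at hs₁
      linarith
    · exact hpos
  obtain ⟨s, hss₁, hstep⟩ := exists_step_ge f hs₁pos (G := g₁ / 2) (by rw [hf0]; linarith)
  have hs₁r : (s₁ : ℝ) ≤ (((kingU d L e) 0 : ℕ) : ℝ) := by exact_mod_cast hs₁U.le
  have hg₂le : g₁ / 2 / (((kingU d L e) 0 : ℕ) : ℝ) ≤ g₁ / 2 / (s₁ : ℝ) :=
    div_le_div_of_nonneg_left (by positivity) (by exact_mod_cast hs₁pos) hs₁r
  -- the unit step `y → y + e₀` with a large mean drop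
  set y : Tor (kingU d L e) := b + s • unitVec (kingU d L e) 0 with hydef
  have hfs : f s = M y := rfl
  have hfs1 : f (s + 1) = M (y + unitVec (kingU d L e) 0) := by
    simp only [hfdef, hydef, succ_nsmul, add_assoc]
  have hdrop : g₁ / 2 / (((kingU d L e) 0 : ℕ) : ℝ) ≤ |((((L ^ k : ℕ) : ℝ)) ^ (d + 1))⁻¹ * ∑ j : Fin (d + 1) → Fin (L ^ k), D (site (L ^ k) (kingU d L e) (y + unitVec (kingU d L e) 0) j)
      - ((((L ^ k : ℕ) : ℝ)) ^ (d + 1))⁻¹ * ∑ j : Fin (d + 1) → Fin (L ^ k), D (site (L ^ k) (kingU d L e) y j)| := by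
    have h1 : g₁ / 2 / (s₁ : ℝ) ≤ M y - M (y + unitVec (kingU d L e) 0) := by rw [← hfs, ← hfs1]; exact hstep
    have h2 : M y - M (y + unitVec (kingU d L e) 0) ≤ |M (y + unitVec (kingU d L e) 0) - M y| := by rw [abs_sub_comm]; exact le_abs_self _
    exact hg₂le.trans (h1.trans h2)
  obtain ⟨w, hw⟩ := exists_grad_ge_of_blockMean_step (L ^ k) (kingU d L e) D y 0 hdrop
  -- read the witness's `p = 1` entry at the block of `w` through the fine point over `w`
  set x' : Tor (fine (L ^ 1 * L ^ k) (kingU d L e)) := overOff L (kingU d L e) k w 0 with hx'def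
  have hx'b : blockOf (L ^ 1 * L ^ k) (kingU d L e) x' = blockOf (L ^ k) (kingU d L e) w := by rw [hx'def, blockOf_overOff]
  have hmem : x' ∈ kingBlockFibre (L ^ 1 * L ^ k) (kingU d L e) (blockOf (L ^ k) (kingU d L e) w) := (mem_kingBlockFibre _ _ _ x').2 hx'b
  have hunder : underPtN L k 1 (kingU d L e) x' = w := underPtN_overOff L (kingU d L e) k w 0
  refine ⟨blockOf (L ^ k) (kingU d L e) w, ?_⟩
  set S := (kingBlockFibre (L ^ 1 * L ^ k) (kingU d L e) (blockOf (L ^ k) (kingU d L e) w)).sup' (kingBlockFibre_nonempty _ _ _) (fun x' =>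
    ∑ μ : Fin (d + 1), |((L ^ 1 * L ^ k : ℕ) : ℝ) *
        (kingH L (L ^ 1 * L ^ k) (kingU d L e) a m2 (k + 1) b (x' + unitVec (fine (L ^ 1 * L ^ k) (kingU d L e)) μ) - kingH L (L ^ 1 * L ^ k) (kingU d L e) a m2 (k + 1) b x')
      - ((L ^ k : ℕ) : ℝ) *
        (kingH L (L ^ k) (kingU d L e) a (m2 + c) k b (underPtN L k 1 (kingU d L e) x' + unitVec (fine (L ^ k) (kingU d L e)) μ)
          - kingH L (L ^ k) (kingU d L e) a (m2 + c) k b (underPtN L k 1 (kingU d L e) x'))|) with hSdef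
  -- the three gradients at `(x′, w)` in direction `0`
  set A' : ℝ := ((L ^ 1 * L ^ k : ℕ) : ℝ) *
    (kingH L (L ^ 1 * L ^ k) (kingU d L e) a m2 (k + 1) b (x' + unitVec (fine (L ^ 1 * L ^ k) (kingU d L e)) 0) - kingH L (L ^ 1 * L ^ k) (kingU d L e) a m2 (k + 1) b x') with hA'
  set A0 : ℝ := ((L ^ k : ℕ) : ℝ) * (kingH L (L ^ k) (kingU d L e) a m2 k b (w + unitVec (fine (L ^ k) (kingU d L e)) 0) - kingH L (L ^ k) (kingU d L e) a m2 k b w) with hA0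
  set Ac : ℝ := ((L ^ k : ℕ) : ℝ) *
    (kingH L (L ^ k) (kingU d L e) a (m2 + c) k b (w + unitVec (fine (L ^ k) (kingU d L e)) 0) - kingH L (L ^ k) (kingU d L e) a (m2 + c) k b w) with hAc
  have hsup : |A' - Ac| ≤ S := by
    have h := Finset.le_sup' (fun x' => ∑ μ : Fin (d + 1), |((L ^ 1 * L ^ k : ℕ) : ℝ) *
        (kingH L (L ^ 1 * L ^ k) (kingU d L e) a m2 (k + 1) b (x' + unitVec (fine (L ^ 1 * L ^ k) (kingU d L e)) μ) - kingH L (L ^ 1 * L ^ k) (kingU d L e) a m2 (k + 1) b x')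
      - ((L ^ k : ℕ) : ℝ) *
        (kingH L (L ^ k) (kingU d L e) a (m2 + c) k b (underPtN L k 1 (kingU d L e) x' + unitVec (fine (L ^ k) (kingU d L e)) μ)
          - kingH L (L ^ k) (kingU d L e) a (m2 + c) k b (underPtN L k 1 (kingU d L e) x'))|) hmem
    rw [hunder] at h
    refine le_trans ?_ h
    exact Finset.single_le_sum (f := fun μ : Fin (d + 1) => |((L ^ 1 * L ^ k : ℕ) : ℝ) *
        (kingH L (L ^ 1 * L ^ k) (kingU d L e) a m2 (k + 1) b (x' + unitVec (fine (L ^ 1 * L ^ k) (kingU d L e)) μ) - kingH L (L ^ 1 * L ^ k) (kingU d L e) a m2 (k + 1) b x')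
      - ((L ^ k : ℕ) : ℝ) * (kingH L (L ^ k) (kingU d L e) a (m2 + c) k b (w + unitVec (fine (L ^ k) (kingU d L e)) μ) - kingH L (L ^ k) (kingU d L e) a (m2 + c) k b w)|)
      (fun μ _ => abs_nonneg _) (Finset.mem_univ (0 : Fin (d + 1)))
  have hstepD : |A' - A0| ≤ CD * θ ^ k := by
    have h := HD e k hk b 0 x'
    rw [hunder] at h
    refine h.trans ?_
    have hE : Real.exp (-(δD * tdistT (kingU d L e) (blockOf (L ^ 1 * L ^ k) (kingU d L e) x') b)) ≤ 1 :=
      Real.exp_le_one_iff.mpr (by nlinarith [(tdistT_isPseudoDist (kingU d L e)).nonneg (blockOf (L ^ 1 * L ^ k) (kingU d L e) x') b, hδD])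
    exact mul_le_of_le_one_right (by positivity) hE
  have hgrad : g₁ / 2 / (((kingU d L e) 0 : ℕ) : ℝ) ≤ |A0 - Ac| := by
    refine hw.trans (le_of_eq ?_)
    rw [hA0, hAc, hDdef]
    ring_nf
  have htri : |A0 - Ac| ≤ |A' - A0| + |A' - Ac| := by
    calc |A0 - Ac| = |(A0 - A') + (A' - Ac)| := by ring_nf
      _ ≤ |A0 - A'| + |A' - Ac| := abs_add_le _ _
      _ = |A' - A0| + |A' - Ac| := by rw [abs_sub_comm]
  linarith

/-- **THE `p = 1` DRESSED SITE ENTRY OF THE WITNESS TOWER, ON THE PART-8c FAMILY**: with `e, g, C` of `dsiteSup_sizeOnly_ge` (size `c > 0`), for every `s`,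
every `k ≥ 1` and the index `i = (e, k, 1, Msz)`, the tower `v_N = c·[N = L^k]` has an observation block `y` with
`(dkingHSiteV L a m² s i).ker v y b ≥ g − C(L^{−1∕4})^k`. [cite: King1986, Prop. 3.8 (3.71) p.664 (second line, A = 0 model)] -/
theorem dkingHSiteV_sizeOnly_ge (hLodd : Odd L) (hL : 2 ≤ L) {a m2 : ℝ} (ha : 0 < a) (hm : 0 < m2) {c : ℝ} (hc : 0 < c) :
    ∃ (e : ℕ) (g C : ℝ), 0 < g ∧ 0 ≤ C ∧ ∀ (s : ℝ) (k : ℕ) (hk : 1 ≤ k) (Msz : ℝ) (hMsz : 1 ≤ Msz) (b : Tor (kingU d L e)),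
      ∃ y : Tor (kingU d L e), g - C * ((L : ℝ) ^ (-((1 / 2 : ℝ) / 2))) ^ k
        ≤ (dkingHSiteV L a m2 s ⟨e, k, hk, 1, le_rfl, Msz, hMsz⟩).ker (fun N _ => if N = L ^ k then c else 0) y b := by
  obtain ⟨e, g, C, hg, hC, H⟩ := dsiteSup_sizeOnly_ge (d := d) L hLodd hL ha hm hc
  refine ⟨e, g, C, hg, hC, fun s k hk Msz hMsz b => ?_⟩
  obtain ⟨y, hy⟩ := H k hk b
  refine ⟨y, ?_⟩
  have hne : ¬ (L ^ 1 * L ^ k = L ^ k) := by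
    have h1 : L ^ k < L ^ 1 * L ^ k := by
      rw [← pow_add]
      exact Nat.pow_lt_pow_right (by omega) (by omega)
    omega
  show _ ≤ (kingBlockFibre (L ^ 1 * L ^ k) (kingU d L e) y).sup' (kingBlockFibre_nonempty _ _ y) (fun x' =>
    ∑ μ : Fin (d + 1), |dkingHPotStep L a m2 e k (fun N _ => if N = L ^ k then c else 0) b μ x'|)
  simp only [dkingHPotStep, if_neg hne, if_true, kingHPot_const, add_zero]
  exact hy

end Lower

/-! ## §3 `NE2PlusSite` fails for the gradient entry on the size-only sort -/

section NotSite

variable (L : ℕ) [NeZero L]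

/-- **`NE2PlusSite` FAILS FOR THE DRESSED MINIMISER'S GRADIENT SUP ENTRY ON THE SIZE-ONLY SORT** (odd `L ≥ 3`, `a, m² > 0`; EVERY `c₃₅ > 0`, `s`,
`d′`, `p`): `¬ NE2PlusSite d′ p c₃₅ (kingInstanceV L s) (dkingHSiteV L a m² s)`.  Given constants `(M₅, δ, a₀, C, γ)`: `α₀ = a₀∕max(M₅,1)`, `c = c₃₅α₀`,
the volume exponent `e` of `dsiteSup_sizeOnly_ge`, the index `(e, k, 1, max(M₅,1))` with `k` large and the (3.35)-regular tower `v_N = c·[N = L^k]`: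
`EtaRateIneqSite` at the block `(y, b)` of §2 would give `ker ≤ C(L^{−γ})^k` (the factor `e^{−δ|y−b|} ≤ 1` dropped), against `ker ≥ g − C_D(L^{−1∕4})^k`.
CONTRAST: on the size-and-coherence sort the same kernel satisfies `NE2PlusSite` (part 19b `ne2PlusSite_dkingHSC`).  HONEST SCOPE: module docstring.
[cite: Balaban1985BackgroundPropagators, (3.35)–(3.36) p.396 + (3.133) p.422 + Thm 3.14 pp.426–427 (quantifier template); King1986, Prop. 3.8 (3.71) p.664 (second line, A = 0 model)] -/
theorem not_ne2PlusSite_dkingHV (hLodd : Odd L) (hL : 2 ≤ L) {a m2 : ℝ} (ha : 0 < a) (hm : 0 < m2) {c35 : ℝ} (hc : 0 < c35)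
    (s : ℝ) (d' : ℕ) (p : ℝ) : ¬ NE2PlusSite d' p c35 (kingInstanceV (d := d) L s) (dkingHSiteV L a m2 s) := by
  rintro ⟨M₅, δ, a₀, C, γ, hM, hδ, ha₀, hC, hγ, H⟩
  have hL1 : 1 < L := by omega
  have hLr : (1 : ℝ) < L := by exact_mod_cast hL1
  set Msz : ℝ := max M₅ 1 with hMszdef
  have hMsz1 : 1 ≤ Msz := le_max_right _ _
  have hMszpos : 0 < Msz := by positivity
  set α₀ : ℝ := a₀ / Msz with hα₀def
  have hα₀ : 0 < α₀ := by positivity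
  have hMa : Msz * α₀ ≤ a₀ := by rw [hα₀def, mul_div_cancel₀ a₀ hMszpos.ne']
  have hcα : 0 < c35 * α₀ := by positivity
  obtain ⟨e, g, CD, hg, hCD, Hlow⟩ := dkingHSiteV_sizeOnly_ge (d := d) L hLodd hL ha hm hcα
  -- the two rates and a level beating both
  set r : ℝ := (L : ℝ) ^ (-((1 / 2 : ℝ) / 2)) with hrdef
  set θ : ℝ := (L : ℝ) ^ (-γ) with hθdef
  have hr0 : 0 ≤ r := Real.rpow_nonneg (Nat.cast_nonneg _) _
  have hθ0 : 0 ≤ θ := Real.rpow_nonneg (Nat.cast_nonneg _) _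
  have hr1 : r < 1 := Real.rpow_lt_one_of_one_lt_of_neg hLr (by norm_num)
  have hθ1 : θ < 1 := Real.rpow_lt_one_of_one_lt_of_neg hLr (by linarith)
  obtain ⟨n₁, hn₁⟩ := exists_pow_lt_of_lt_one (show 0 < g / 4 / (CD + 1) by positivity) hr1
  obtain ⟨n₂, hn₂⟩ := exists_pow_lt_of_lt_one (show 0 < g / 4 / C by positivity) hθ1
  set k : ℕ := n₁ + n₂ + 1 with hkdef
  have hk1 : 1 ≤ k := by omega
  have hrk : r ^ k ≤ r ^ n₁ := pow_le_pow_of_le_one hr0 hr1.le (by omega)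
  have hθk : θ ^ k ≤ θ ^ n₂ := pow_le_pow_of_le_one hθ0 hθ1.le (by omega)
  have hsmall₁ : CD * r ^ k ≤ g / 4 := by
    have h1 : CD * r ^ k ≤ (CD + 1) * r ^ n₁ := mul_le_mul (by linarith) hrk (pow_nonneg hr0 _) (by linarith)
    have h3 : (CD + 1) * (g / 4 / (CD + 1)) = g / 4 := by field_simp
    linarith [mul_le_mul_of_nonneg_left hn₁.le (by linarith : (0 : ℝ) ≤ CD + 1)]
  have hsmall₂ : C * θ ^ k ≤ g / 4 := by
    have h3 : C * (g / 4 / C) = g / 4 := by field_simp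
    linarith [mul_le_mul_of_nonneg_left (hθk.trans hn₂.le) hC.le]
  -- the index, the source block, the witness, and the observation block of §2
  set i : KingPotIdx d := ⟨e, k, hk1, 1, le_rfl, Msz, hMsz1⟩ with hidef
  set b : Tor (kingU d L e) := fun _ => 0 with hbdef
  have h335 : (kingInstanceV (d := d) L s i).Bf.Reg335 c35 α₀ (fun N _ => if N = L ^ k then c35 * α₀ else 0) := by
    intro N x
    show |(if N = L ^ k then c35 * α₀ else (0 : ℝ))| ≤ c35 * α₀
    by_cases h : N = L ^ k
    · rw [if_pos h, abs_of_pos hcα]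
    · rw [if_neg h, abs_zero]; exact hcα.le
  obtain ⟨y, hy⟩ := Hlow s k hk1 Msz hMsz1 b
  have hineq := H i (le_max_left M₅ 1) α₀ hα₀ hMa _ h335 y b
  simp only [kingInstanceV_len, kingInstanceV_rateFactor_rpow L hL, max_self, Real.one_rpow, mul_one] at hineq
  have hexp : Real.exp (-(δ * (kingInstanceV (d := d) L s i).gc.dist y b)) ≤ 1 := by
    rw [Real.exp_le_one_iff]
    have h0 : 0 ≤ (kingInstanceV (d := d) L s i).gc.dist y b := (tdistT_isPseudoDist (kingU d L e)).nonneg y b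
    nlinarith
  have hup : (dkingHSiteV L a m2 s i).ker (fun N _ => if N = L ^ k then c35 * α₀ else 0) y b ≤ C * θ ^ k := by
    refine (le_abs_self _).trans (hineq.trans ?_)
    have : C * Real.exp (-(δ * (kingInstanceV (d := d) L s i).gc.dist y b)) ≤ C := mul_le_of_le_one_right hC.le hexp
    exact mul_le_mul_of_nonneg_right this (pow_nonneg hθ0 _)
  linarith

end NotSite

end Summit.QuantumFields.YangMills.BalabanUVNodes.N15.KingModel

end
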